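import Summits.HodgeConjecture.HodgeCM.Model.Binders.CMTypeFlips_1

/-! PORT of `HodgeCM/Model/Binders/CMTypeFlips.lean` (HodgeCMPerL run 81) — part 2: continuation of `Summits.HodgeConjecture.HodgeCM.Model.Binders.CMTypeFlips_1` (split at a top-level declaration boundary by port_pkg.py; scope re-opened below; declarations unchanged). -/

-- port_pkg: scope re-opened for this part (file-level context, then the namespace/section stack open at the cut)
set_option autoImplicit false
open scoped Pointwise
namespace HodgeCM
namespace CMTypeFlips
open Literature.NumberTheory.ComplexMultiplication
variable {G : Type*} [Group G] {E : Type*} [MulAction G E]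
section Flips
variable {c : E → E}
/-- **Single-pair flips from size**: `E` has six points, `c` is a `G`-equivariant fixed-point-free involution realised by some `ρ ∈ G`, `G` acts
faithfully and transitively, and `|G| ≥ 24` (for a sextic CM field: `[K̃:ℚ] ∈ {24, 48}`).  Then `G` has single-pair flips.  Proof: the stabiliser
`H₁` of a point has `|H₁| = |G|/6 ≥ 4`; inside it, either a non-trivial element fixes a second pair — it is then an exact flip of the third pair —
or `H₁` moves `e₂` to `c e₂`, giving an element that flips pair 2 and fixes pair 1, which is an exact flip of pair 2 or, times `ρ`, of pair 1.
[folklore] -/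
theorem hasFlips_of_card [Fintype E] [DecidableEq E] [Finite G] [MulAction.IsPretransitive G E]
    (hcG : ∀ (g : G) (e : E), g • c e = c (g • e)) (hcc : ∀ e : E, c (c e) = e) (hc : ∀ e : E, c e ≠ e)
    (hfaith : ∀ g : G, (∀ e : E, g • e = e) → g = 1) (ρ : G) (hρ : ∀ e : E, ρ • e = c e)
    (hE : Fintype.card E = 6) (hG : 24 ≤ Nat.card G) : HasFlips G c := by
  have hinj := injective_of_invol hcc
  -- two points in different pairs
  obtain ⟨e₁⟩ : Nonempty E := Fintype.card_pos_iff.1 (by omega)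
  -- the stabiliser of `e₁` has at least four elements
  set H₁ := MulAction.stabilizer G e₁ with hH₁
  have hH₁card : 6 * Nat.card H₁ = Nat.card G := by
    have h := H₁.index_mul_card
    rw [hH₁, MulAction.index_stabilizer_of_transitive, Nat.card_eq_fintype_card, hE] at h
    exact h
  have hH₁ge : 4 ≤ Nat.card H₁ := by omega
  -- a point `e₂` outside the pair of `e₁`
  have hex₂ : ∃ e₂ : E, e₂ ≠ e₁ ∧ e₂ ≠ c e₁ := by
    by_contra h
    push Not at h
    have : (Finset.univ : Finset E) ⊆ {e₁, c e₁} := fun y _ => by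
      rcases eq_or_ne y e₁ with rfl | hy
      · simp
      · simp [h y hy]
    have := Finset.card_le_card this
    rw [Finset.card_univ, hE] at this
    exact absurd (this.trans (Finset.card_insert_le _ _)) (by simp)
  obtain ⟨e₂, h₂₁, h₂₁'⟩ := hex₂
  -- a point `x` outside both pairs
  have hex : ∃ x : E, x ≠ e₁ ∧ x ≠ c e₁ ∧ x ≠ e₂ ∧ x ≠ c e₂ := by
    by_contra h
    push Not at h
    have : (Finset.univ : Finset E) ⊆ {e₁, c e₁, e₂, c e₂} := fun y _ => by
      by_cases h1 : y = e₁; · simp [h1]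
      by_cases h2 : y = c e₁; · simp [h2]
      by_cases h3 : y = e₂; · simp [h3]
      simp [h y h1 h2 h3]
    have := Finset.card_le_card this
    rw [Finset.card_univ, hE] at this
    have h4 : ({e₁, c e₁, e₂, c e₂} : Finset E).card ≤ 4 :=
      (Finset.card_insert_le _ _).trans (by
        have := (Finset.card_insert_le (c e₁) ({e₂, c e₂} : Finset E))
        have h2 : ({e₂, c e₂} : Finset E).card ≤ 2 := Finset.card_le_two
        omega)
    omega
  obtain ⟨x, hx₁, hx₁', hx₂, hx₂'⟩ := hex
  have six := eq_or_of_card_six hE hc hcc h₂₁ h₂₁' hx₁ hx₁' hx₂ hx₂'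
  -- elements of `H₁` fix `e₁` and `c e₁`
  have fix₁ : ∀ h : H₁, (h : G) • e₁ = e₁ := fun h => h.2
  have fix₁' : ∀ h : H₁, (h : G) • c e₁ = c e₁ := fun h => by rw [hcG, fix₁ h]
  -- orbit–stabiliser inside `H₁` for `e₂`
  set H₁₂ := MulAction.stabilizer H₁ e₂ with hH₁₂
  have hos : (MulAction.orbit H₁ e₂).ncard * Nat.card H₁₂ = Nat.card H₁ := by
    rw [← MulAction.index_stabilizer]; exact H₁₂.index_mul_card
  by_cases hk : 1 < Nat.card H₁₂
  · -- Case (i): a non-trivial `k` fixing `e₁` and `e₂`: it is an exact flip at `x`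
    obtain ⟨⟨k, hk₁₂⟩, hk1⟩ := H₁₂.ne_bot_iff_exists_ne_one.1 (H₁₂.one_lt_card_iff_ne_bot.1 hk)
    have hk₂ : (k : G) • e₂ = e₂ := MulAction.mem_stabilizer_iff.1 hk₁₂
    have hk₂' : (k : G) • c e₂ = c e₂ := by rw [hcG, hk₂]
    have hk₁ : (k : G) • e₁ = e₁ := fix₁ k
    have hk₁' : (k : G) • c e₁ = c e₁ := fix₁' k
    -- `k` moves some point, necessarily `x` or `c x`, and then `k • x = c x`
    have hkx : (k : G) • x = c x := by
      have hne : (k : G) ≠ 1 := fun h => hk1 (Subtype.ext (Subtype.ext h))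
      obtain ⟨y, hy⟩ : ∃ y, (k : G) • y ≠ y := by
        by_contra h; push Not at h; exact hne (hfaith _ h)
      -- `y ∈ {x, c x}`
      have hy' : y = x ∨ y = c x := by
        rcases six y with rfl | rfl | rfl | rfl | rfl | rfl
        · exact absurd hk₁ hy
        · exact absurd hk₁' hy
        · exact absurd hk₂ hy
        · exact absurd hk₂' hy
        · exact Or.inl rfl
        · exact Or.inr rfl
      -- `k • x ∉ {e₁, c e₁, e₂, c e₂, x}`
      have hkx' : (k : G) • x ≠ x := by
        rcases hy' with rfl | rfl
        · exact hy
        · intro h; exact hy (by rw [hcG, h])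
      rcases six ((k : G) • x) with h | h | h | h | h | h
      · exact absurd (smul_left_cancel _ (h.trans hk₁.symm)) hx₁
      · exact absurd (smul_left_cancel _ (h.trans hk₁'.symm)) hx₁'
      · exact absurd (smul_left_cancel _ (h.trans hk₂.symm)) hx₂
      · exact absurd (smul_left_cancel _ (h.trans hk₂'.symm)) hx₂'
      · exact absurd h hkx'
      · exact h
    refine hasFlips_of_exists_flip hcG hkx fun e' h1 h2 => ?_
    rcases six e' with rfl | rfl | rfl | rfl | rfl | rfl
    · exact hk₁
    · exact hk₁'
    · exact hk₂
    · exact hk₂'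
    · exact absurd rfl h1
    · exact absurd rfl h2
  · -- Case (ii): `H₁₂` trivial, so the `H₁`-orbit of `e₂` has `≥ 4` points and contains `c e₂`
    have hk1 : Nat.card H₁₂ = 1 := by
      have : 0 < Nat.card H₁₂ := Nat.card_pos
      omega
    rw [hk1, mul_one] at hos
    have hmem : c e₂ ∈ MulAction.orbit H₁ e₂ := by
      by_contra hnot
      have hsub : MulAction.orbit (↥H₁) e₂ ⊆ ({e₂, x, c x} : Set E) := by
        rintro y ⟨h, rfl⟩
        have hy₁ : (h : G) • e₂ ≠ e₁ := fun hh => h₂₁ (smul_left_cancel (h : G) (hh.trans (fix₁ h).symm))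
        have hy₁' : (h : G) • e₂ ≠ c e₁ := fun hh => h₂₁' (smul_left_cancel (h : G) (hh.trans (fix₁' h).symm))
        have hy₂' : (h : G) • e₂ ≠ c e₂ := fun hh => hnot ⟨h, hh⟩
        show (h : G) • e₂ ∈ ({e₂, x, c x} : Set E)
        rcases six ((h : G) • e₂) with hh | hh | hh | hh | hh | hh
        · exact absurd hh hy₁
        · exact absurd hh hy₁'
        · simp [hh]
        · exact absurd hh hy₂'
        · simp [hh]
        · simp [hh]
      have hle : (MulAction.orbit (↥H₁) e₂).ncard ≤ 3 :=
        (Set.ncard_le_ncard hsub (Set.toFinite _)).trans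
          ((Set.ncard_insert_le _ _).trans (by
            have := Set.ncard_insert_le x ({c x} : Set E)
            rw [Set.ncard_singleton] at this
            omega))
      omega
    obtain ⟨h, hh⟩ := hmem
    have hh₂ : (h : G) • e₂ = c e₂ := hh
    have hh₂' : (h : G) • c e₂ = e₂ := by rw [hcG, hh₂, hcc]
    have hh₁ : (h : G) • e₁ = e₁ := fix₁ h
    have hh₁' : (h : G) • c e₁ = c e₁ := fix₁' h
    -- `h • x ∈ {x, c x}`
    have hhx : (h : G) • x = x ∨ (h : G) • x = c x := by
      rcases six ((h : G) • x) with e | e | e | e | e | e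
      · exact absurd (smul_left_cancel _ (e.trans hh₁.symm)) hx₁
      · exact absurd (smul_left_cancel _ (e.trans hh₁'.symm)) hx₁'
      · exact absurd (smul_left_cancel _ (e.trans hh₂'.symm)) hx₂'
      · exact absurd (smul_left_cancel _ (e.trans hh₂.symm)) hx₂
      · exact Or.inl e
      · exact Or.inr e
    rcases hhx with hhx | hhx
    · -- exact flip at `e₂`
      have hhx' : (h : G) • c x = c x := by rw [hcG, hhx]
      refine hasFlips_of_exists_flip hcG hh₂ fun e' h1 h2 => ?_
      rcases six e' with rfl | rfl | rfl | rfl | rfl | rfl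
      · exact hh₁
      · exact hh₁'
      · exact absurd rfl h1
      · exact absurd rfl h2
      · exact hhx
      · exact hhx'
    · -- `h` flips pairs 2 and 3: `h * ρ` is an exact flip at `e₁`
      have hhx' : (h : G) • c x = x := by rw [hcG, hhx, hcc]
      refine hasFlips_of_exists_flip hcG (x := e₁) (f := (h : G) * ρ) ?_ fun e' h1 h2 => ?_
      · rw [mul_smul, hρ, hh₁']
      · rw [mul_smul, hρ]
        rcases six e' with rfl | rfl | rfl | rfl | rfl | rfl
        · exact absurd rfl h1
        · exact absurd rfl h2
        · rw [hh₂']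
        · rw [hcc, hh₂]
        · rw [hhx']
        · rw [hcc, hhx]

end Flips

end CMTypeFlips

end HodgeCM
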